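import Summits.CriticalPhenomena.CardyFormulaZ2.Theorems.CardyComplexConeParafermionToSLESixFamiliesDiamondDefs
import HarnessLib

/-!
# The start edge of an admissible family sits at a mark; local discrete-boundary criteria
# (line `potential-darboux-picard-diamond`, S1′: lattice input for the phase anchor and the escapes)

Crux `ParafermionToSLESixFamilies` (stmt-CriticalPhenomena-11389), line `potential-darboux-picard-diamond`, stub
`stub_exactPotentialTracePh` (S1′). The phase anchor `u δ` of `ExactPotentialTracePh` is read off the start corner
`startCorner hδ` of `Λ δ` (the corner whose source is the `A`–`B` edge `e_a`), and the escape paths that make the winding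
at boundary darts deterministic (`Literature/…/MedialExplorationVertexEscape.lean`) end at it. This file records:

* `eventually_startCorner_near_marks` (registered, `--supports` the crux) — along an admissible family the midpoint of
  the start edge `e_a = cSrc (startCorner hδ)` is eventually within any `ε > 0` of one of the two marks `D.pt 0`,
  `D.pt 1` (it is an `A`–`B` edge, and the `A`–`B` edges converge to the marks in Hausdorff distance: clause five of
  `IsFamily`);
* local criteria for the discrete boundary of data `E`: a site with a lattice neighbour whose mesh point is outside
  `E.Ω` is a discrete boundary site (`mem_zdBoundary_of_adj_not_mem_carrier`); so is the vertex of a sourced or targeted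
  face-boundary edge (`mem_zdBoundary_of_isOutEdge`, `mem_zdBoundary_of_isInEdge`); a face with a corner outside is not
  inner (`not_isInnerFace_of_corner_not_mem`).
-/

noncomputable section

namespace Summit.CriticalPhenomena.CardyFormulaZ2.Cruxes.ParafermionToSLESixFamilies.PotentialDarbouxPicardDiamond

open scoped Topology NNReal ENNReal
open Filter Set Metric Complex
open Literature.Probability Literature.Probability.LatticeModels Literature.Probability.Percolation
open Literature.Probability.LatticeModels.DiscreteDobrushin
open Literature.Probability.RandomPlanarGeometry
open Summit.CriticalPhenomena.CardyFormulaZ2.Cruxes.ParafermionToSLESixFamilies.IicTraceFluxPairing (IsFamily)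

/-! ## Local criteria for the discrete boundary -/

/-- A face with a corner whose mesh point lies outside the domain is not inner. -/
theorem not_isInnerFace_of_corner_not_mem {E : DiscreteDobrushin} {f v : Site 2} (hv : IsCorner v f)
    (hout : meshPoint E.δ v ∉ E.Ω) : ¬ E.IsInnerFace f := by
  intro hf
  obtain ⟨k, rfl⟩ := exists_faceAt_of_isCorner hv
  have hadj := adj_of_isInnerFace_faceAt (k := k) hf (Or.inl rfl)
  exact hout (meshDomain_subset_meshVertices _ _ (discreteDomainGraph_adj_iff.1 hadj).2.1)

/-- A site of `Ω_δ` with a lattice neighbour whose mesh point lies outside the domain is a discrete boundary site. -/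
theorem mem_zdBoundary_of_adj_not_mem_carrier {E : DiscreteDobrushin} {x y : Site 2}
    (hx : x ∈ meshDomain E.Ω E.δ) (hxy : (zdGraph 2).Adj x y) (hy : meshPoint E.δ y ∉ E.Ω) : x ∈ E.zdBoundary :=
  E.meshBoundary_subset_zdBoundary
    (mem_meshBoundary_of_adj_not_mem hx hxy fun h => hy (meshDomain_subset_meshVertices _ _ h))

/-- The vertex of a sourced face-boundary edge is a discrete boundary site. -/
theorem mem_zdBoundary_of_isOutEdge {E : DiscreteDobrushin} {x : Site 2} {k : Fin 4} (h : E.IsOutEdge x k) :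
    x ∈ E.zdBoundary :=
  h.isFaceBoundaryEdge.mem_zdBoundary.1

/-- The vertex of a targeted face-boundary edge is a discrete boundary site. -/
theorem mem_zdBoundary_of_isInEdge {E : DiscreteDobrushin} {x : Site 2} {k : Fin 4} (h : E.IsInEdge x k) :
    x ∈ E.zdBoundary :=
  h.isFaceBoundaryEdge.mem_zdBoundary.1

/-! ## The start edge sits at a mark -/

/-- The start edge is an `A`–`B` edge. -/
theorem cSrc_startCorner_mem_zdABEdges {E : DiscreteDobrushin} (hE : E.IsZdAdmissible) :
    cSrc (startCorner hE) ∈ E.zdABEdges :=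
  let h := isStartCorner_startCorner hE
  cSrc_mem_zdABEdges h.mem_zdArcA h.mem_zdArcB (Or.inl h.isOutEdge)

/-- **The start edge of an admissible family sits at a mark** (registered helper of `stub_exactPotentialTracePh`):
for every `ε > 0`, eventually in `δ`, the midpoint of `e_a = cSrc (startCorner hδ)` is within `ε` of `D.pt 0` or of
`D.pt 1`. -/
theorem eventually_startCorner_near_marks : ∀ (D : DobrushinDomain) (Λ : ℝ → DiscreteDobrushin), IsFamily D Λ → ∀ ε : ℝ, 0 < ε → ∀ᶠ δ in 𝓝[>] (0:ℝ), ∀ hδ : (Λ δ).IsZdAdmissible, dist (medialPoint δ (cSrc (startCorner hδ))) (D.pt 0) ≤ ε ∨ dist (medialPoint δ (cSrc (startCorner hδ))) (D.pt 1) ≤ ε := by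
  intro D Λ hΛ ε hε
  obtain ⟨-, -, -, -, hAB, -⟩ := hΛ
  filter_upwards [hAB.eventually_lt_const (ENNReal.ofReal_pos.2 hε)] with δ hδ hadm
  have hmem : medialPoint δ (cSrc (startCorner hadm)) ∈ medialPoint δ '' (Λ δ).zdABEdges :=
    mem_image_of_mem _ (cSrc_startCorner_mem_zdABEdges hadm)
  obtain ⟨y, hy, hdy⟩ := exists_edist_lt_of_hausdorffEDist_lt hmem hδ
  rw [edist_lt_ofReal] at hdy
  rcases hy with rfl | rfl
  · exact Or.inl hdy.le
  · exact Or.inr hdy.le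

end Summit.CriticalPhenomena.CardyFormulaZ2.Cruxes.ParafermionToSLESixFamilies.PotentialDarbouxPicardDiamond

end
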